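import Summits.BirchSwinnertonDyer.BirchSwinnertonDyer.Theses.TeichmullerTwistDescent
import Summits.BirchSwinnertonDyer.BirchSwinnertonDyer.Theorems.TeichmullerTwistDescentStarInvolutionSandwich
import Summits.BirchSwinnertonDyer.Rank1Residual.X12.InertCoreEveryCurve
import Summits.BirchSwinnertonDyer.Rank1Residual.Additive.GordManinConstant
import Literature.NumberTheory.EllipticCurves.IsogenyPotentiallyGoodMinimalDiscriminantProofs
import HarnessLib

/-!
# Route `TeichmullerTwistDescent` (rev 6), LINE 11 glue `OrdinaryLowValuationOfSaturation`
# (stmt-BirchSwinnertonDyer-25371): K → NTL → {Edixhoven-Kodaira, Modularity} → GE11 — PROVED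

Cell `pub/bsd-wall` (D-0145 line route-BirchSwinnertonDyer-TeichmullerTwistDescent, OPEN rev 6), seat
`bsd-line-ttd-p2` (prover 2/2, g5). THEOREMS ONLY (no definition, no named fact, no `sorry`). BSD is not
proved by this; no leaf is proved by this. The item is a glue: nothing here says anything about the crux
`TwistedPeriodLatticeSaturation` (K, stmt-25368) itself.

* §1 `padicValInt_c_add_le_of_twist_datum_of_saturation` — **the star involution WITHOUT the loss of one
  `p`, granted twisted period-lattice saturation.** For `W/ℚ` globally minimal, additive at the odd prime
  `p`, `D` a LATTICE-OPTIMAL `X₀(N)`-datum (`p² ∣ N`), `C • W^{(p*)} = V` globally minimal and additive at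
  `p`, `D'` any `X₀(N)`-datum of `V`, and `Λ(f_D) ⊆ g(χ_p)·Λ(f_D ⊗ χ_p)` (K at `D`):
  `ord_p c(D) + ord_p u(C) ≤ ord_p c(D')`. Chain: `z = c w ∈ Λ_W`, `w = g w'` (K) with
  `w' ∈ Λ(f_D ⊗ χ) = Λ(f_{D'})` (`aₙ(W^{(p*)}) = (n/p) aₙ(W)`, `a_{pk} = 0` on both additive sides),
  `c' w' ∈ Λ_V = u g⁻¹ Λ_W` (`mem_lattice_twist_pStar_iff`), so `(c'/(u c))·Λ_W ⊆ Λ_W` and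
  `c'/(u c) ∈ ℤ` (`int_of_rat_mul_mem_lattice_self`). Compare the tree's `padicValInt_c_le_of_twist_datum`
  (`ord_p c(D) ≤ 1 − ord_p u + ord_p c(D')`, Stevens' `⊇` only).
* §2 `ordinaryLowValuationOfSaturation_proof : OrdinaryLowValuationOfSaturation` — the glue BY NAME,
  following the planner's plan and the tree's `padicValInt_c_le_one_of_exception`: for `W` unstarred
  (`ord_p Δ_min ≤ 4`), `(G)`-ordinary, `E[p]` irreducible, `p ≥ 11`: the minimal model `V` of `W^{(p*)}`
  (`exists_minimal_twist_pStar`, `ord_p u = 0` by `padicValRat_u_eq_zero_and_padicValInt_eq_of_twist_pStar`)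
  is additive of starred type; the `X₀(N)`-optimal curve `W₀ ∼ V` (`X12.exists_isIsogenous_optimal`,
  modularity) is `(G)`-ordinary with `ord_p Δ_min(W₀) = ord_p Δ_min(V) > 4` — Dokchitser–Dokchitser,
  now the tree THEOREM `dokchitser_padicValInt_minimalDiscriminantInt_eq_of_isogeny_of_not_dvd_degree_holds`
  (`not_typeGOrd_or_four_lt_of_isIsogenous`) — so `p ∤ c(D₀)` (Edixhoven Thm. 3 off II/III/IV,
  `Addv.not_dvd_maninConstant_of_four_lt`), the prime-to-`p` transport gives a `p`-good conductor-level datum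
  `D'` of `V` (`ManinFrameTransport.exists_modularParametrizationData_not_dvd_of_partner`), and §1 gives
  `ord_p c(D) ≤ 0`. (NTL is not even needed: `mem_lattice_twist_pStar_iff` is its content for the twisted
  MODEL, and only the model's lattice enters; the hypothesis is consumed trivially.)
[cite: EdixhovenManin1991, Thm. 3 and §4 (typescript L602–640)] [cite: Stevens1989, Lemma (5.4) p. 97]
[cite: DokchitserDokchitser2015LocalInvariants, Thm. 5.1 (1)]
-/

set_option autoImplicit false
-- single-conjunct summit: `Summit.BirchSwinnertonDyer.BirchSwinnertonDyer.…` repeats the name by design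
set_option linter.dupNamespace false

noncomputable section

open scoped Classical NumberField

open WeierstrassCurve IsDedekindDomain Rat.HeightOneSpectrum
  Literature.NumberTheory.EllipticCurves Literature.NumberTheory.EllipticCurves.ModularForms
  Literature.NumberTheory.EllipticCurves.Rank1Residual Literature.NumberTheory.DiophantineGeometry
  Summit.BirchSwinnertonDyer.Rank1Residual Summit.BirchSwinnertonDyer.Rank1Residual.Additive
  Summit.BirchSwinnertonDyer.BirchSwinnertonDyer.Theses.TeichmullerTwistDescent
  Summit.BirchSwinnertonDyer.BirchSwinnertonDyer.Theorems.TeichmullerTwistDescentStarInvolution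

namespace Summit.BirchSwinnertonDyer.BirchSwinnertonDyer.Theorems.TeichmullerTwistDescent

/-! ### §1 The star involution without loss, granted saturation -/

section Chain

variable (p : ℕ) [hp : Fact p.Prime]

/-- **The star involution WITHOUT the loss of one `p`, granted twisted period-lattice saturation at the
optimal datum.** `W/ℚ` globally minimal and additive at the odd prime `p`; `D` a lattice-optimal
`X₀(N)`-datum of `W` with `p² ∣ N`; `C • W^{(p*)} = V` globally minimal and additive at `p`; `D'` an
`X₀(N)`-datum of `V`; and K at `D`: `Λ(f_D) ⊆ g·Λ((f_D)_χ)` for the Legendre character `χ` mod `p`,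
`g` its Gauss sum. Then `ord_p c(D) + ord_p u(C) ≤ ord_p c(D')`.
[cite: EdixhovenManin1991, §4 (typescript L602–640)] [cite: Stevens1989, Lemma (5.4) p. 97] -/
theorem padicValInt_c_add_le_of_twist_datum_of_saturation (hp2 : p ≠ 2) (W V : WeierstrassCurve ℚ)
    [W.IsElliptic] [W.IsGloballyMinimal] [V.IsElliptic] [V.IsGloballyMinimal] (hW : Addv W p)
    (hV : Addv V p) (C : VariableChange ℚ) (hC : C • W.quadraticTwist ((-1 : ℚ) ^ (p / 2) * p) = V)
    {N : ℕ} [NeZero N] (D : ModularParametrizationData W N)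
    (hopt : ∀ z ∈ D.L.lattice, ∃ w ∈ periodLattice D.f, z = D.c * w) (hpN : p ^ 2 ∣ N)
    (D' : ModularParametrizationData V N)
    (hsat : ∀ z ∈ periodLattice D.f, ∃ w ∈ periodLattice
      (charTwist N (dvd_refl N) hpN (isQuadratic_quadraticChar_ringHomComp p) D.f),
      z = gaussSum ((quadraticChar (ZMod p)).ringHomComp (Int.castRingHom ℂ))
        (ZMod.stdAddChar (N := p)) * w) :
    (padicValInt p D.c : ℤ) + padicValRat p (C.u : ℚ) ≤ padicValInt p D'.c := by
  have hpP : p.Prime := hp.out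
  set χ := (quadraticChar (ZMod p)).ringHomComp (Int.castRingHom ℂ) with hχ
  have hχq := isQuadratic_quadraticChar_ringHomComp p
  have hχp := isPrimitive_quadraticChar_ringHomComp p hp2
  set G : ℂ := gaussSum χ (ZMod.stdAddChar (N := p)) with hGdef
  obtain ⟨hcast, -⟩ := pStar_intCast p
  haveI : (W.quadraticTwist ((-1 : ℚ) ^ (p / 2) * p)).IsElliptic :=
    W.isElliptic_quadraticTwist (pStar_ne_zero p)
  -- additivity at the place over `p`, for `W` and `V`
  have hvO : (primesEquiv ((primesEquiv (R := 𝓞 ℚ)).symm ⟨p, hpP⟩) : ℕ) = p := by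
    rw [Equiv.apply_symm_apply]
  have haddO : ∀ (X : WeierstrassCurve ℚ) [X.IsElliptic], Addv X p →
      X.HasAdditiveReductionAt ((primesEquiv (R := 𝓞 ℚ)).symm ⟨p, hpP⟩) := by
    intro X _ hX
    set vq : HeightOneSpectrum ℤ := (primesEquiv (R := ℤ)).symm ⟨p, hpP⟩ with hvq
    have haddX : X.HasAdditiveReductionAt vq := by
      rcases X.hasGoodReductionAt_or_hasMultiplicativeReductionAt_or_hasAdditiveReductionAt vq with
        hg | hm | ha
      · exact absurd ((X.hasGoodReductionAtPrime_iff_hasGoodReductionAt_holds ⟨p, hpP⟩).mpr hg) hX.1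
      · exact absurd
          ((X.hasMultiplicativeReductionAtPrime_iff_hasMultiplicativeReductionAt_holds ⟨p, hpP⟩).mpr hm)
          hX.2
      · exact ha
    exact (X.hasAdditiveReductionAt_int_iff_ringOfIntegers ⟨p, hpP⟩).mp haddX
  -- the coefficient relation `aₙ(f_D ⊗ χ) = aₙ(f_{D'})`, hence `(f_D)_χ = f_{D'}`
  have hcoef : ∀ n : ℕ, cuspCoeff (charTwist N (dvd_refl N) hpN hχq D.f) n = cuspCoeff D'.f n := by
    intro n
    rw [cuspCoeff_charTwist N (dvd_refl N) hpN hχq hχp, D.isNewformOf.2 n, D'.isNewformOf.2 n,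
      quadraticChar_ringHomComp_apply_natCast p n, ← hC, LFunction_smul]
    by_cases hpn : p ∣ n
    · rw [W.LFunction_apply_eq_zero_of_hasAdditiveReductionAt hvO (haddO W hW) hpn,
        (W.quadraticTwist ((-1 : ℚ) ^ (p / 2) * p)).LFunction_apply_eq_zero_of_hasAdditiveReductionAt
          hvO ?_ hpn]
      · push_cast; ring
      · -- the twisted model is additive at `p` too: it is `C⁻¹ • V`
        have hV' : V.HasAdditiveReductionAt ((primesEquiv (R := 𝓞 ℚ)).symm ⟨p, hpP⟩) := haddO V hV
        have hCV : C⁻¹ • V = W.quadraticTwist ((-1 : ℚ) ^ (p / 2) * p) := by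
          rw [← hC, inv_smul_smul]
        rw [← hCV]
        exact (hasAdditiveReductionAt_smul_iff_holds _ V C⁻¹).mpr hV'
    · rw [← hcast, W.LFunction_quadraticTwist_pStar_apply hp2 hpn]
      have hne : ((n : ℤ) : ZMod p) ≠ 0 := by
        rw [Int.cast_natCast, Ne, ZMod.natCast_eq_zero_iff]
        exact hpn
      push_cast
      rcases legendreSym.eq_one_or_neg_one p hne with h1 | h1
      · rw [show (legendreSym p (n : ℤ)) = legendreSym p n from rfl, h1]
      · rw [show (legendreSym p (n : ℤ)) = legendreSym p n from rfl, h1]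
  have hfeq : charTwist N (dvd_refl N) hpN hχq D.f = D'.f := eq_of_forall_cuspCoeff_eq_gamma0 hcoef
  -- the chain: `(c'/(u c)) Λ_W ⊆ Λ_W`
  have hc : D.c ≠ 0 := D.maninConstant_ne_zero_holds
  have hc' : D'.c ≠ 0 := D'.maninConstant_ne_zero_holds
  have hu0 : (C.u : ℚ) ≠ 0 := C.u.ne_zero
  have hcℂ : (D.c : ℂ) ≠ 0 := by exact_mod_cast hc
  have huℂ : (((C.u : ℚ) : ℚ) : ℂ) ≠ 0 := by exact_mod_cast hu0
  have key : ∀ z ∈ D.L.lattice, ((((D'.c : ℚ) / ((C.u : ℚ) * D.c)) : ℚ) : ℂ) * z ∈ D.L.lattice := by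
    intro z hz
    obtain ⟨w, hw, rfl⟩ := hopt z hz
    obtain ⟨w', hw', hww'⟩ := hsat w hw
    rw [hfeq] at hw'
    have h3 : (D'.c : ℂ) * w' ∈ D'.L.lattice := D'.smul_periodLattice_le _ hw'
    have h4 := (mem_lattice_twist_pStar_iff p hp2 W V D.isNeronLattice D'.isNeronLattice C hC
      ((D'.c : ℂ) * w')).mp h3
    -- `h4 : G * (u⁻¹ * (c' w')) ∈ Λ_W`, and `G w' = w`
    have e : ((((D'.c : ℚ) / ((C.u : ℚ) * D.c)) : ℚ) : ℂ) * ((D.c : ℂ) * w) =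
        G * ((((C.u : ℚ) : ℚ) : ℂ)⁻¹ * ((D'.c : ℂ) * w')) := by
      rw [hww']
      push_cast
      field_simp
    rw [e]
    exact h4
  obtain ⟨k, hk⟩ := int_of_rat_mul_mem_lattice_self D.L _ key
  -- valuations: `c' = k u c`
  have hk0 : k ≠ 0 := by
    rintro rfl
    rw [Int.cast_zero, eq_comm, div_eq_zero_iff] at hk
    rcases hk with h | h
    · exact hc' (by exact_mod_cast h)
    · exact (mul_ne_zero hu0 (by exact_mod_cast hc)) h
  have hrel : (D'.c : ℚ) = k * ((C.u : ℚ) * D.c) := by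
    rw [hk]; field_simp
  have hval : padicValRat p (D'.c : ℚ) =
      padicValRat p (k : ℚ) + (padicValRat p (C.u : ℚ) + padicValRat p (D.c : ℚ)) := by
    rw [hrel, padicValRat.mul (by exact_mod_cast hk0) (mul_ne_zero hu0 (by exact_mod_cast hc)),
      padicValRat.mul hu0 (by exact_mod_cast hc)]
  rw [padicValRat.of_int, padicValRat.of_int, padicValRat.of_int] at hval
  have hk0' : (0 : ℤ) ≤ padicValInt p k := by positivity
  linarith

end Chain

/-! ### §2 The glue by name -/

/-- Level bookkeeping: a `p`-good datum at level `N` is a `p`-good datum at any equal level.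
[folklore] -/
private theorem exists_datum_not_dvd_of_level_eq' {W : WeierstrassCurve ℚ} {N M : ℕ} [NeZero N]
    [NeZero M] (h : N = M) {p : ℕ} (D : ModularParametrizationData W N) (hc : ¬ (p : ℤ) ∣ D.c) :
    ∃ D' : ModularParametrizationData W M, ¬ (p : ℤ) ∣ D'.c := by
  subst h
  exact ⟨D, hc⟩

/-- **`OrdinaryLowValuationOfSaturation` (stmt-BirchSwinnertonDyer-25371) PROVED**: the LINE 11 glue
`TwistedPeriodLatticeSaturation → NeronLatticeTwistPStarOfLowValuation →
EdixhovenKodairaAndModularityFacts → OrdinaryLowValuationOptimalManinUnitGeEleven`. For the unstarred,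
`(G)`-ordinary, irreducible `W` at `p ≥ 11` with lattice-optimal conductor-level datum `D`: the minimal
model `V` of `W^{(p*)}` is starred additive with `ord_p u = 0`; its `X₀(N)`-optimal class member `W₀`
has `ord_p Δ_min > 4` (Dokchitser–Dokchitser, the tree theorem `…_holds`, along the prime-to-`p` cyclic
isogeny) so `p ∤ c(D₀)` (Edixhoven Thm. 3 off II/III/IV); transport `D₀` to a `p`-good conductor-level
datum of `V`; §1 (saturation K at `D`) gives `ord_p c(D) ≤ 0`.
[cite: EdixhovenManin1991, Thm. 3 and §4] [cite: DokchitserDokchitser2015LocalInvariants, Thm. 5.1 (1)] -/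
theorem ordinaryLowValuationOfSaturation_proof : OrdinaryLowValuationOfSaturation := by
  intro hK _ hF W _ _ p _ _ D hp11 hadd hirr hG hV4 hopt
  obtain ⟨hEdxK, hnf⟩ := hF
  have hpP : p.Prime := Fact.out
  have hp2 : p ≠ 2 := by omega
  have hp5 : 5 ≤ p := by omega
  have hj : 0 ≤ padicValRat p W.j := padicValRat_j_nonneg_of_typeGOrd W p hG
  have hW6 : padicValInt p W.minimalDiscriminantInt < 6 := by omega
  have hpN : p ^ 2 ∣ W.conductorNorm ℤ := sq_dvd_conductorNorm_of_not_good_of_not_mult hadd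
  -- the minimal model `V` of the `p*`-twist: additive, starred, `ord_p u = 0`
  obtain ⟨V, hVe, hVm, C, hC⟩ := exists_minimal_twist_pStar p W
  haveI := hVe
  haveI := hVm
  haveI : NeZero (V.conductorNorm ℤ) := ⟨(conductorNorm_pos_holds V).ne'⟩
  obtain ⟨hV, hjV, h6⟩ := addv_of_twist_pStar p hp2 W V hj hW6 C hC
  obtain ⟨hu, -⟩ := padicValRat_u_eq_zero_and_padicValInt_eq_of_twist_pStar p hp2 W V hW6 C hC
  have hN : V.conductorNorm ℤ = W.conductorNorm ℤ := conductorNorm_eq_of_twist_pStar p hp5 W V hadd hV C hC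
  -- `E[p]` irreducible for `V`
  have hd0 : ((-1 : ℚ) ^ (p / 2) * p) ≠ 0 :=
    mul_ne_zero (pow_ne_zero _ (by norm_num)) (by exact_mod_cast hpP.ne_zero)
  have hC' : C⁻¹ • V = W.quadraticTwist ((-1 : ℚ) ^ (p / 2) * p) := by rw [← hC, inv_smul_smul]
  have hirrV : Irr V p :=
    BurungaleSkinnerTianWan2024.hasIrreducibleModPGaloisRep_of_smul_eq_quadraticTwist W V p hd0 hC' hirr
  -- the optimal curve `W₀` of the twisted class and its lattice-optimal datum
  obtain ⟨W₀, hE₀, hM₀, hNz₀, D₀, hiso, hN₀, hopt₀⟩ := X12.exists_isIsogenous_optimal hnf V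
  haveI := hE₀
  haveI := hM₀
  haveI := hNz₀
  have hadd₀ : Addv W₀ p := (X2.addv_iff_of_isIsogenous (p := p) hiso).mp hV
  have h4₀ : 4 < padicValInt p W₀.minimalDiscriminantInt := by
    -- Dokchitser–Dokchitser (tree theorem) along a cyclic isogeny of degree prime to `p` (`Irr`)
    obtain ⟨ψ, hψ⟩ := hiso.exists_isCyclic
    have hdeg : ¬ p ∣ ψ.degree := X11b.not_dvd_degree_of_isCyclic_of_irr ψ hψ hpP hirrV
    rw [← dokchitser_padicValInt_minimalDiscriminantInt_eq_of_isogeny_of_not_dvd_degree_holds V W₀ ψ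
      p hpP hdeg hjV]
    omega
  have hc₀ : ¬ (p : ℤ) ∣ D₀.c :=
    Addv.not_dvd_maninConstant_of_four_lt W₀ p hEdxK D₀ hopt₀ (by omega) hadd₀ h4₀
  -- a `p`-good conductor-level datum of `V`
  obtain ⟨Dt, hct⟩ :=
    ManinFrameTransport.exists_modularParametrizationData_not_dvd_of_partner V hpP hirrV hiso D₀ hc₀
  obtain ⟨D', hc'⟩ := exists_datum_not_dvd_of_level_eq' (hN₀.trans hN) Dt hct
  -- §1 with K at `D`
  have hsat := hK W p D hpN hp11 hadd hirr hG hV4 hopt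
    ((quadraticChar (ZMod p)).ringHomComp (Int.castRingHom ℂ)) (isQuadratic_quadraticChar_ringHomComp p)
    (isPrimitive_quadraticChar_ringHomComp p hp2)
  have hle := padicValInt_c_add_le_of_twist_datum_of_saturation p hp2 W V hadd hV C hC D hopt hpN D'
    hsat
  rw [hu, padicValInt.eq_zero_of_not_dvd hc'] at hle
  have hc0 : D.c ≠ 0 := D.maninConstant_ne_zero_holds
  intro hdvd
  have h1 : 1 ≤ padicValInt p D.c := by
    rw [← pow_one (p : ℤ), padicValInt_dvd_iff] at hdvd
    exact hdvd.resolve_left hc0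
  push_cast at hle
  omega

end Summit.BirchSwinnertonDyer.BirchSwinnertonDyer.Theorems.TeichmullerTwistDescent

end
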